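import Literature.NumberTheory.GaloisRepresentations.LubinTateColemanRelativeLimitTwo
import Literature.NumberTheory.GaloisRepresentations.DecompositionGroupOfCompletion
import Literature.NumberTheory.EllipticCurves.DeShalit1987.AvatarArtinLift
import Literature.NumberTheory.Automorphic.AdicCompletionResidueCard
import Literature.NumberTheory.EllipticCurves.DeShalitThetaTExpansionIntegral
import HarnessLib

/-!
# The Frobenius twist of the coefficients READ FROM GLOBAL DATA: `φ` on `𝒪_E` is the Artin symbol `σ_𝔭` on `K(𝔪)`
# (de Shalit II.4.9 (ii) / II.4.7 (18): `φ⁻ⁿ Q` is the `t`-expansion at the `σ_𝔭^{-n}`-conjugate data)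

Topic `NumberTheory/EllipticCurves` (theorems only; no definition, no named fact, no instance).  In de Shalit's construction of the
`𝔭`-adic measure (II §4.5–4.10) the Coleman power series `g_β` of a norm-coherent unit has coefficients in `𝒪_E`, `E ⊆ F^{nr}`
(`F = K_𝔭`), and the interpolation runs through the FROBENIUS TWISTS `φ^{-n} g_β` (`φ` acting on the coefficients; the tree's
`frobUnitBall E σ₀`, `σ₀ ∈ Γ_F` an arithmetic Frobenius).  When the coefficients are READ FROM GLOBAL DATA — `G = Q_R^{ψ_𝔓}` with
`Q_R` the algebraic theta `t`-expansion over a ring `R` of elements of a ray class field `K(𝔪)` (`𝔭 ∤ 𝔪`) and `ψ_𝔓 : R → 𝒪_E` the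
`𝔓`-adic reading through the chosen embedding `K̄ → K̄_𝔭` (`absClosureEmbedding`) — the twist is computed on the data: II.4.9 (ii)
«`(φ⁻ⁿP)(z) = Θ(Λ(𝔭⁻ⁿ)w_n − z; Λ(𝔭⁻ⁿ)𝔭ⁿL, 𝔞)`», II.4.7 (18) «`σ_𝔮 = φ`».  This file proves exactly that dictionary:

* §1 (any local field `F`, any `E/F` finite normal inside `F̄`, any `τ ∈ Γ_F`): `coe_coe_frobUnitBall` (`φ_τ x = τ • x` in `F̄`),
  `coe_coe_frobUnitBall_symm` (`φ_τ⁻¹ x = τ⁻¹ • x`); ★ `frobUnitBall_apply_eq_of_reading` — if `ψ : R → 𝒪_E` reads `ρ : R → K̄`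
  through `e = absClosureEmbedding K F` (`ψ r = e(ρ r)`) and `σ_R : R → R` covers `res τ ∈ Γ_K` (`ρ(σ_R r) = res τ • ρ r`,
  `res = absGaloisRestrict K F`), then **`φ_τ (ψ r) = ψ (σ_R r)`**; the same for `φ_τ⁻¹` (`…_symm_…`); as ring maps
  (`ringHom_frobUnitBall_comp_eq_of_reading`) and ON POWER SERIES: ★ `map_frobUnitBall_map_eq_of_reading`
  (`(Q^{ψ})^{φ} = (Q^{σ_R})^{ψ}`), `map_frobUnitBall_symm_map_eq_of_reading`, ★ `map_frobUnitBall_symm_iterate_map_eq_of_reading`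
  (`(φ⁻¹)^{n} (Q^ψ) = ((σ_R⁻¹)^n Q)^ψ` — the shape `(map (frobUnitBall E σ₀).symm)^[m+1] G` of
  `relColemanSeries_eq_subst_subst_of_forall_evS`).
* §2 (`K` a number field, `F = K_v`, `σ₀` an ARITHMETIC FROBENIUS of `K_v`): `isArithFrobAt_absGaloisRestrict_adicCompletionPrime`
  (`res σ₀` is a Frobenius at the prime `𝔓₀ ∣ v` cut out by `e`); ★★ `absRestrictNormalHom_rayClassField_absGaloisRestrict_eq_galFrob`
  — **`(res σ₀)|_{K(𝔪)} = (v, K(𝔪)/K)`** for `v ∤ 𝔪` (Artin symbol = arithmetic Frobenius `galFrob`); pointwise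
  `absGaloisRestrict_smul_coe_rayClassField_eq_galFrob` (`res σ₀ • y = σ_v y`), `…_inv_smul_…` (`(res σ₀)⁻¹ • y = σ_v⁻¹ y`).
* §3 (the lane's shape, `F = K_v`, data in `K(𝔪)`): ★★ `frobUnitBall_apply_eq_galFrob_of_reading` (`φ (ψ r) = ψ (σ_v r)`),
  `frobUnitBall_symm_apply_eq_galFrob_symm_of_reading`, and for de Shalit's theta `t`-expansion
  `Q_R = C K·∏ (invOfUnit (x(P₀ − P(t)) − x_c) u_c)⁶` (`DeShalitThetaTExpansionIntegral`): ★★★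
  `map_frobUnitBall_map_thetaTExpansion_eq` — **`(Q_R(W; x₀, y₀, x_c, K)^{ψ_𝔓})^{φ} = Q_R(W^{σ_v}; σ_v x₀, σ_v y₀, σ_v x_c, σ_v K)^{ψ_𝔓}`**
  and ★★★ `map_frobUnitBall_symm_iterate_map_thetaTExpansion_eq` — `(φ⁻¹)^n (Q_R^{ψ_𝔓}) = Q_R(W^{σ⁻ⁿ}; σ⁻ⁿx₀, …)^{ψ_𝔓}`, `σ⁻ⁿ = (σ_v⁻¹)^n`
  (de Shalit II.4.9 (ii)).  These discharge the hypothesis `hGφ` of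
  `Summits/…/PrintCf2RubinValueTwoKatzMeasureJZeroSeamPerUnit.map_frob_relCoatesWiles_eq_of_bridge` from its `hG` (same `ψ_𝔓`, conjugate data)
  and identify the series in the `hval` of `relColemanSeries_eq_subst_subst_of_forall_evS`.

What is NOT here: which complex numbers the conjugate data are (`ι̂(σ_𝔞 x(ξ z)) = x(ξ(ψ(𝔞)z))` — the reciprocity law II.1.5 (15),
the tree's named fact `DeShalit1987.prop15_grossencharacterReciprocity`); the choice of `R`, `ψ_𝔓`, `E` for the lane (the CM bridge's).
Cell `bsd-print-cf2`, width seat `bsd-line-cf2-p1-w7` g15 (piece (Gφ)); nothing here closes a crux; no summit statement is proved;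
BSD is not proved by any of this.

## References
* [deShalit1987] E. de Shalit, *Iwasawa theory of elliptic curves with complex multiplication* (1987), II §4.7 (16)–(18) (p. 60),
  II §4.9 Proposition (ii) and its proof (p. 62–63), I §2.2.
* [NeukirchANT1999] J. Neukirch, *Algebraic Number Theory* (1999), Ch. II §9 Prop. (9.6) (decomposition group of the completion),
  Ch. I §9, Ch. VI §7 (7.1) (Artin symbol at an unramified prime = Frobenius).
* [SerreLocalFields1979] J.-P. Serre, *Local Fields* (1979), Ch. I §8 (Frobenius of an unramified extension).
-/

noncomputable section

open scoped NumberField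
open Field IsDedekindDomain ValuativeRel PowerSeries
open Literature.NumberTheory.GaloisRepresentations Literature.NumberTheory.GaloisRepresentations.IsNonarchimedeanLocalField
  Literature.NumberTheory.GaloisRepresentations.LubinTate Literature.NumberTheory.NumberFields

namespace Literature.NumberTheory.EllipticCurves

/-! ## §1. `φ_τ` on `𝒪_E` versus `τ` on `F̄` and `res τ` on `K̄` -/

section Generic

variable {F : Type*} [Field F] [ValuativeRel F] [TopologicalSpace F] [IsNonarchimedeanLocalField F]

attribute [local instance] ltNormUniformSpace ltNormIsUniformAddGroup rk1 nF nE fintypeResidueField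

variable (E : IntermediateField F (AlgebraicClosure F)) [FiniteDimensional F E] [Normal F E]

/-- **`φ_τ x = τ • x`**: the automorphism `frobUnitBall E τ` of `𝒪_E` (restriction of `τ ∈ Γ_F` to the normal `E`) acts on
`x ∈ 𝒪_E ⊂ E ⊂ F̄` as `τ` does. [cite: SerreLocalFields1979, Ch. I §7 Prop. 20, §8] -/
theorem coe_coe_frobUnitBall (τ : absoluteGaloisGroup F) (x : unitBall E) :
    (((frobUnitBall E τ x : unitBall E) : E) : AlgebraicClosure F) = τ • ((x : E) : AlgebraicClosure F) :=
  coe_restrictNormal_apply E τ (x : E)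

/-- **`φ_τ⁻¹ x = τ⁻¹ • x`** (the inverse twist, de Shalit's `φ⁻¹` on the coefficients). [cite: SerreLocalFields1979, Ch. I §8]
[cite: deShalit1987, I §2.2] -/
theorem coe_coe_frobUnitBall_symm (τ : absoluteGaloisGroup F) (x : unitBall E) :
    ((((frobUnitBall E τ).symm x : unitBall E) : E) : AlgebraicClosure F) = τ⁻¹ • ((x : E) : AlgebraicClosure F) := by
  rw [eq_inv_smul_iff, ← coe_coe_frobUnitBall E τ ((frobUnitBall E τ).symm x), RingEquiv.apply_symm_apply]

variable {K : Type*} [Field K] [Algebra K F]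

/-- ★ **The twist computed on global data**: if `ψ : R → 𝒪_E` reads `ρ : R → K̄` through the chosen embedding
`e = absClosureEmbedding K F : K̄ → F̄` (`ψ r = e(ρ r)` as elements of `F̄`) and `σ_R : R → R` covers the restriction
`res τ ∈ Γ_K` of `τ ∈ Γ_F` (`ρ(σ_R r) = res τ • ρ r`), then `φ_τ (ψ r) = ψ (σ_R r)`.
[cite: deShalit1987, II §4.7 (18), II §4.9 (ii)] [cite: NeukirchANT1999, Ch. II §9 Prop. (9.6)] -/
theorem frobUnitBall_apply_eq_of_reading {R : Type*} (ψ : R → unitBall E) (ρ : R → AlgebraicClosure K)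
    (hψ : ∀ r, (((ψ r : unitBall E) : E) : AlgebraicClosure F) = absClosureEmbedding K F (ρ r))
    (τ : absoluteGaloisGroup F) {σR : R → R} (hσR : ∀ r, ρ (σR r) = absGaloisRestrict K F τ • ρ r) (r : R) :
    frobUnitBall E τ (ψ r) = ψ (σR r) := by
  refine Subtype.ext (Subtype.ext ?_)
  calc (((frobUnitBall E τ (ψ r) : unitBall E) : E) : AlgebraicClosure F)
      = τ • (((ψ r : unitBall E) : E) : AlgebraicClosure F) := coe_coe_frobUnitBall E τ (ψ r)
    _ = τ • absClosureEmbedding K F (ρ r) := by rw [hψ]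
    _ = absClosureEmbedding K F (absGaloisRestrict K F τ • ρ r) := (absGaloisRestrict_apply_smul K F τ (ρ r)).symm
    _ = absClosureEmbedding K F (ρ (σR r)) := by rw [hσR]
    _ = (((ψ (σR r) : unitBall E) : E) : AlgebraicClosure F) := (hψ (σR r)).symm

/-- ★ **The inverse twist on global data**: with `τ_R` covering `(res τ)⁻¹` (`ρ(τ_R r) = (res τ)⁻¹ • ρ r`),
`φ_τ⁻¹ (ψ r) = ψ (τ_R r)`. [cite: deShalit1987, II §4.9 (ii)] [cite: NeukirchANT1999, Ch. II §9 Prop. (9.6)] -/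
theorem frobUnitBall_symm_apply_eq_of_reading {R : Type*} (ψ : R → unitBall E) (ρ : R → AlgebraicClosure K)
    (hψ : ∀ r, (((ψ r : unitBall E) : E) : AlgebraicClosure F) = absClosureEmbedding K F (ρ r))
    (τ : absoluteGaloisGroup F) {τR : R → R} (hτR : ∀ r, ρ (τR r) = (absGaloisRestrict K F τ)⁻¹ • ρ r) (r : R) :
    (frobUnitBall E τ).symm (ψ r) = ψ (τR r) := by
  refine Subtype.ext (Subtype.ext ?_)
  calc ((((frobUnitBall E τ).symm (ψ r) : unitBall E) : E) : AlgebraicClosure F)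
      = τ⁻¹ • (((ψ r : unitBall E) : E) : AlgebraicClosure F) := coe_coe_frobUnitBall_symm E τ (ψ r)
    _ = τ⁻¹ • absClosureEmbedding K F (ρ r) := by rw [hψ]
    _ = absClosureEmbedding K F (absGaloisRestrict K F τ⁻¹ • ρ r) := (absGaloisRestrict_apply_smul K F τ⁻¹ (ρ r)).symm
    _ = absClosureEmbedding K F (ρ (τR r)) := by rw [hτR, map_inv]
    _ = ((((ψ (τR r)) : unitBall E) : E) : AlgebraicClosure F) := (hψ (τR r)).symm

variable {R : Type*} [CommRing R] (ψ : R →+* unitBall E) (ρ : R → AlgebraicClosure K)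
  (hψ : ∀ r, (((ψ r : unitBall E) : E) : AlgebraicClosure F) = absClosureEmbedding K F (ρ r)) (τ : absoluteGaloisGroup F)

include hψ

/-- As ring maps: `φ_τ ∘ ψ = ψ ∘ σ_R`. [cite: deShalit1987, II §4.9 (ii)] -/
theorem ringHom_frobUnitBall_comp_eq_of_reading {σR : R →+* R} (hσR : ∀ r, ρ (σR r) = absGaloisRestrict K F τ • ρ r) :
    (frobUnitBall E τ : unitBall E →+* unitBall E).comp ψ = ψ.comp σR :=
  RingHom.ext fun r => frobUnitBall_apply_eq_of_reading E ψ ρ hψ τ hσR r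

/-- As ring maps: `φ_τ⁻¹ ∘ ψ = ψ ∘ τ_R`. [cite: deShalit1987, II §4.9 (ii)] -/
theorem ringHom_frobUnitBall_symm_comp_eq_of_reading {τR : R →+* R} (hτR : ∀ r, ρ (τR r) = (absGaloisRestrict K F τ)⁻¹ • ρ r) :
    ((frobUnitBall E τ).symm : unitBall E →+* unitBall E).comp ψ = ψ.comp τR :=
  RingHom.ext fun r => frobUnitBall_symm_apply_eq_of_reading E ψ ρ hψ τ hτR r

/-- ★ **On power series: `(Q^{ψ})^{φ_τ} = (Q^{σ_R})^{ψ}`** — the Frobenius twist of the coefficients of a series read from `R` is the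
series of the conjugate data read the same way. [cite: deShalit1987, II §4.9 Proposition (ii)] -/
theorem map_frobUnitBall_map_eq_of_reading {σR : R →+* R} (hσR : ∀ r, ρ (σR r) = absGaloisRestrict K F τ • ρ r) (Q : PowerSeries R) :
    PowerSeries.map (frobUnitBall E τ : unitBall E →+* unitBall E) (PowerSeries.map ψ Q) = PowerSeries.map ψ (PowerSeries.map σR Q) := by
  rw [← RingHom.comp_apply (PowerSeries.map _) (PowerSeries.map ψ), ← PowerSeries.map_comp,
    ringHom_frobUnitBall_comp_eq_of_reading E ψ ρ hψ τ hσR, PowerSeries.map_comp, RingHom.comp_apply]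

/-- ★ `(Q^{ψ})^{φ_τ⁻¹} = (Q^{τ_R})^{ψ}`. [cite: deShalit1987, II §4.9 Proposition (ii)] -/
theorem map_frobUnitBall_symm_map_eq_of_reading {τR : R →+* R} (hτR : ∀ r, ρ (τR r) = (absGaloisRestrict K F τ)⁻¹ • ρ r)
    (Q : PowerSeries R) :
    PowerSeries.map ((frobUnitBall E τ).symm : unitBall E →+* unitBall E) (PowerSeries.map ψ Q) = PowerSeries.map ψ (PowerSeries.map τR Q) := by
  rw [← RingHom.comp_apply (PowerSeries.map _) (PowerSeries.map ψ), ← PowerSeries.map_comp,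
    ringHom_frobUnitBall_symm_comp_eq_of_reading E ψ ρ hψ τ hτR, PowerSeries.map_comp, RingHom.comp_apply]

/-- ★ **`(φ_τ⁻¹)^{n} (Q^{ψ}) = (Q^{τ_R^n})^{ψ}`** — the shape `(map (frobUnitBall E σ₀).symm)^[m+1] G` of the interpolation property
(`relColemanSeries_eq_subst_subst_of_forall_evS`), for a series read from global data: de Shalit's `φ⁻ⁿ Q`.
[cite: deShalit1987, II §4.9 Proposition (ii) (proof: «`(φ⁻ⁿP)(z) = Θ(Λ(𝔭⁻ⁿ)w_n − z; …)`»)] -/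
theorem map_frobUnitBall_symm_iterate_map_eq_of_reading {τR : R →+* R} (hτR : ∀ r, ρ (τR r) = (absGaloisRestrict K F τ)⁻¹ • ρ r)
    (n : ℕ) (Q : PowerSeries R) :
    (PowerSeries.map ((frobUnitBall E τ).symm : unitBall E →+* unitBall E))^[n] (PowerSeries.map ψ Q) =
      PowerSeries.map ψ (PowerSeries.map (τR ^ n) Q) := by
  induction n generalizing Q with
  | zero => rw [Function.iterate_zero_apply, pow_zero, RingHom.one_def, PowerSeries.map_id]; rfl
  | succ n ih =>
    rw [Function.iterate_succ_apply, map_frobUnitBall_symm_map_eq_of_reading E ψ ρ hψ τ hτR, ih, pow_succ, RingHom.mul_def,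
      PowerSeries.map_comp, RingHom.comp_apply]

end Generic

/-! ## §2. `K` a number field, `F = K_v`: the restriction of an arithmetic Frobenius of `K_v` is the Artin symbol at `v` -/

section NumberField

variable {K : Type} [Field K] [NumberField K] (v : HeightOneSpectrum (𝓞 K))

/-- **`res σ₀` is an arithmetic Frobenius at `𝔓₀`**: for an arithmetic Frobenius `σ₀` of the local field `K_v` (the valued structure of
the completion), its restriction to `K̄` along the chosen embedding is an arithmetic Frobenius at the prime `𝔓₀ = adicCompletionPrime K v`
above `v` (`DecompositionGroupOfCompletion`, with the residue-field count `q(K_v) = #(𝓞_K/v)` discharged).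
[cite: NeukirchANT1999, Ch. II §9 Prop. (9.6)] -/
theorem isArithFrobAt_absGaloisRestrict_adicCompletionPrime {σ₀ : absoluteGaloisGroup (v.adicCompletion K)}
    (hσ₀ : IsAbsArithFrob σ₀) :
    IsArithFrobAt (𝓞 K) (absGaloisRestrict K (v.adicCompletion K) σ₀) (adicCompletionPrime K v) :=
  (isArithFrobAt_absGaloisRestrict_adicCompletionPrime_iff K v
    (by rw [Literature.NumberTheory.Automorphic.residueFieldCard_adicCompletion_eq, HeightOneSpectrum.residueCard_eq_card_quotient]) σ₀).mpr hσ₀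

variable {v}

/-- ★★ **`(res σ₀)|_{K(𝔪)} = (v, K(𝔪)/K)`**: for `v ∤ 𝔪` (so `v` is unramified in the ray class field `K(𝔪)`), the restriction to
`K(𝔪)` of (the image in `Γ_K` of) an arithmetic Frobenius `σ₀` of `K_v` is THE Frobenius `galFrob K (K(𝔪)) v` — the Artin symbol of
`v`, de Shalit's `σ_𝔭 = φ` on `K(𝔣)`. [cite: NeukirchANT1999, Ch. VI §7 Thm. (7.1), Ch. II §9 Prop. (9.6)] [cite: deShalit1987, II §4.7 (18)] -/
theorem absRestrictNormalHom_rayClassField_absGaloisRestrict_eq_galFrob {𝔪 : Ideal (𝓞 K)} (h𝔪 : 𝔪 ≠ ⊥)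
    (hv𝔪 : ¬ 𝔪 ≤ v.asIdeal) {σ₀ : absoluteGaloisGroup (v.adicCompletion K)} (hσ₀ : IsAbsArithFrob σ₀) :
    absRestrictNormalHom (rayClassField K 𝔪) (absGaloisRestrict K (v.adicCompletion K) σ₀) = galFrob K (rayClassField K 𝔪) v :=
  absRestrictNormalHom_rayClassField_eq_galFrob h𝔪 hv𝔪 (adicCompletionPrime_mem_primesAbove K v)
    (isArithFrobAt_absGaloisRestrict_adicCompletionPrime v hσ₀)

/-- `((σ|_{K(𝔪)}) y : K̄) = σ • y` (unfolding of the restriction to the normal subextension `K(𝔪)`).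
[cite: NeukirchANT1999, Ch. IV §1 (restriction to a normal subextension)] -/
theorem coe_absRestrictNormalHom_rayClassField_apply {𝔪 : Ideal (𝓞 K)} (σ : absoluteGaloisGroup K) (y : rayClassField K 𝔪) :
    ((absRestrictNormalHom (rayClassField K 𝔪) σ y : rayClassField K 𝔪) : AlgebraicClosure K) = σ • (y : AlgebraicClosure K) :=
  AlgEquiv.restrictNormalHom_apply (rayClassField K 𝔪) _ y

/-- ★ Pointwise: **`res σ₀ • y = (v, K(𝔪)/K) y`** for `y ∈ K(𝔪)`, `v ∤ 𝔪`. [cite: NeukirchANT1999, Ch. VI §7 Thm. (7.1)]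
[cite: deShalit1987, II §4.7 (18)] -/
theorem absGaloisRestrict_smul_coe_rayClassField_eq_galFrob {𝔪 : Ideal (𝓞 K)} (h𝔪 : 𝔪 ≠ ⊥) (hv𝔪 : ¬ 𝔪 ≤ v.asIdeal)
    {σ₀ : absoluteGaloisGroup (v.adicCompletion K)} (hσ₀ : IsAbsArithFrob σ₀) (y : rayClassField K 𝔪) :
    absGaloisRestrict K (v.adicCompletion K) σ₀ • (y : AlgebraicClosure K) =
      ((galFrob K (rayClassField K 𝔪) v y : rayClassField K 𝔪) : AlgebraicClosure K) := by
  rw [← absRestrictNormalHom_rayClassField_absGaloisRestrict_eq_galFrob h𝔪 hv𝔪 hσ₀, coe_absRestrictNormalHom_rayClassField_apply]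

/-- ★ Pointwise, inverse: **`(res σ₀)⁻¹ • y = (v, K(𝔪)/K)⁻¹ y`** (`σ_𝔭⁻¹`, for de Shalit's `φ⁻ⁿ`). [cite: NeukirchANT1999, Ch. VI §7 Thm. (7.1)]
[cite: deShalit1987, II §4.9 (ii)] -/
theorem absGaloisRestrict_inv_smul_coe_rayClassField_eq_galFrob_symm {𝔪 : Ideal (𝓞 K)} (h𝔪 : 𝔪 ≠ ⊥) (hv𝔪 : ¬ 𝔪 ≤ v.asIdeal)
    {σ₀ : absoluteGaloisGroup (v.adicCompletion K)} (hσ₀ : IsAbsArithFrob σ₀) (y : rayClassField K 𝔪) :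
    (absGaloisRestrict K (v.adicCompletion K) σ₀)⁻¹ • (y : AlgebraicClosure K) =
      (((galFrob K (rayClassField K 𝔪) v).symm y : rayClassField K 𝔪) : AlgebraicClosure K) := by
  rw [inv_smul_eq_iff, absGaloisRestrict_smul_coe_rayClassField_eq_galFrob h𝔪 hv𝔪 hσ₀, AlgEquiv.apply_symm_apply]

/-- Powers of the inverse: `(res σ₀)⁻¹ ^ n • y = (σ_v⁻¹)^n y` (as the `n`-fold iterate of `σ_v.symm`).
[cite: deShalit1987, II §4.9 (ii)] -/
theorem absGaloisRestrict_inv_pow_smul_coe_rayClassField {𝔪 : Ideal (𝓞 K)} (h𝔪 : 𝔪 ≠ ⊥) (hv𝔪 : ¬ 𝔪 ≤ v.asIdeal)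
    {σ₀ : absoluteGaloisGroup (v.adicCompletion K)} (hσ₀ : IsAbsArithFrob σ₀) (n : ℕ) (y : rayClassField K 𝔪) :
    (absGaloisRestrict K (v.adicCompletion K) σ₀)⁻¹ ^ n • (y : AlgebraicClosure K) =
      (((fun z ↦ (galFrob K (rayClassField K 𝔪) v).symm z)^[n] y : rayClassField K 𝔪) : AlgebraicClosure K) := by
  induction n generalizing y with
  | zero => rw [pow_zero, one_smul, Function.iterate_zero_apply]
  | succ n ih =>
    rw [pow_succ, mul_smul, absGaloisRestrict_inv_smul_coe_rayClassField_eq_galFrob_symm h𝔪 hv𝔪 hσ₀, ih,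
      Function.iterate_succ_apply]

end NumberField

/-! ## §3. The lane's shape: `F = K_v`, data in a ray class field `K(𝔪)` with `v ∤ 𝔪`, the theta `t`-expansion -/

section Lane

variable {K : Type} [Field K] [NumberField K] {v : HeightOneSpectrum (𝓞 K)}

attribute [local instance] ltNormUniformSpace ltNormIsUniformAddGroup rk1 nF nE fintypeResidueField

variable (E : IntermediateField (v.adicCompletion K) (AlgebraicClosure (v.adicCompletion K)))
  [FiniteDimensional (v.adicCompletion K) E] [Normal (v.adicCompletion K) E]
  {𝔪 : Ideal (𝓞 K)} (h𝔪 : 𝔪 ≠ ⊥) (hv𝔪 : ¬ 𝔪 ≤ v.asIdeal)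
  {σ₀ : absoluteGaloisGroup (v.adicCompletion K)} (hσ₀ : IsAbsArithFrob σ₀)
  {R : Type*} [CommRing R] (ψ : R →+* unitBall E) (ρ : R → rayClassField K 𝔪)
  (hψ : ∀ r, (((ψ r : unitBall E) : E) : AlgebraicClosure (v.adicCompletion K)) =
    absClosureEmbedding K (v.adicCompletion K) ((ρ r : rayClassField K 𝔪) : AlgebraicClosure K))

include h𝔪 hv𝔪 hσ₀ hψ

/-- ★★ **`φ (ψ_𝔓 r) = ψ_𝔓 (σ_v r)`**: for data `ρ : R → K(𝔪)` (`v ∤ 𝔪`) read `𝔓`-adically into `𝒪_E` through the chosen embedding, and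
`σ_R : R → R` covering the Artin symbol `σ_v = (v, K(𝔪)/K)` (`ρ(σ_R r) = σ_v (ρ r)`), the Frobenius `φ = frobUnitBall E σ₀` of an arithmetic
Frobenius `σ₀` of `K_v` acts on `ψ_𝔓 r` as `σ_v` on the datum — de Shalit II.4.7 (18) «`(𝔮, K(𝔪)/K) = (𝔭, K(𝔪)/K)` … `σ_𝔮 = φ`».
[cite: deShalit1987, II §4.7 (16)–(18), II §4.9 (ii)] [cite: NeukirchANT1999, Ch. VI §7 Thm. (7.1)] -/
theorem frobUnitBall_apply_eq_galFrob_of_reading {σR : R → R} (hσR : ∀ r, ρ (σR r) = galFrob K (rayClassField K 𝔪) v (ρ r)) (r : R) :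
    frobUnitBall E σ₀ (ψ r) = ψ (σR r) :=
  frobUnitBall_apply_eq_of_reading E ψ (fun r ↦ ((ρ r : rayClassField K 𝔪) : AlgebraicClosure K)) hψ σ₀
    (fun r ↦ by rw [hσR, absGaloisRestrict_smul_coe_rayClassField_eq_galFrob h𝔪 hv𝔪 hσ₀]) r

/-- ★★ **`φ⁻¹ (ψ_𝔓 r) = ψ_𝔓 (σ_v⁻¹ r)`** with `τ_R` covering `σ_v⁻¹ = (galFrob K K(𝔪) v).symm`. [cite: deShalit1987, II §4.9 (ii)]
[cite: NeukirchANT1999, Ch. VI §7 Thm. (7.1)] -/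
theorem frobUnitBall_symm_apply_eq_galFrob_symm_of_reading {τR : R → R}
    (hτR : ∀ r, ρ (τR r) = (galFrob K (rayClassField K 𝔪) v).symm (ρ r)) (r : R) :
    (frobUnitBall E σ₀).symm (ψ r) = ψ (τR r) :=
  frobUnitBall_symm_apply_eq_of_reading E ψ (fun r ↦ ((ρ r : rayClassField K 𝔪) : AlgebraicClosure K)) hψ σ₀
    (fun r ↦ by rw [hτR, absGaloisRestrict_inv_smul_coe_rayClassField_eq_galFrob_symm h𝔪 hv𝔪 hσ₀]) r

/-- ★★ On power series: **`(Q^{ψ_𝔓})^{φ} = (Q^{σ_R})^{ψ_𝔓}`** for a ring endomorphism `σ_R` of `R` covering `σ_v`.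
[cite: deShalit1987, II §4.9 Proposition (ii)] -/
theorem map_frobUnitBall_map_eq_galFrob_of_reading {σR : R →+* R} (hσR : ∀ r, ρ (σR r) = galFrob K (rayClassField K 𝔪) v (ρ r))
    (Q : PowerSeries R) :
    PowerSeries.map (frobUnitBall E σ₀ : unitBall E →+* unitBall E) (PowerSeries.map ψ Q) = PowerSeries.map ψ (PowerSeries.map σR Q) :=
  map_frobUnitBall_map_eq_of_reading E ψ (fun r ↦ ((ρ r : rayClassField K 𝔪) : AlgebraicClosure K)) hψ σ₀
    (fun r ↦ by rw [hσR, absGaloisRestrict_smul_coe_rayClassField_eq_galFrob h𝔪 hv𝔪 hσ₀]) Q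

/-- ★★ On power series, inverse iterate: **`(φ⁻¹)^{n} (Q^{ψ_𝔓}) = (Q^{τ_R^n})^{ψ_𝔓}`** for a ring endomorphism `τ_R` of `R` covering `σ_v⁻¹`
— the series `(map (frobUnitBall E σ₀).symm)^[m+1] G` of `relColemanSeries_eq_subst_subst_of_forall_evS` when `G = Q^{ψ_𝔓}`.
[cite: deShalit1987, II §4.9 Proposition (ii)] -/
theorem map_frobUnitBall_symm_iterate_map_eq_galFrob_of_reading {τR : R →+* R}
    (hτR : ∀ r, ρ (τR r) = (galFrob K (rayClassField K 𝔪) v).symm (ρ r)) (n : ℕ) (Q : PowerSeries R) :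
    (PowerSeries.map ((frobUnitBall E σ₀).symm : unitBall E →+* unitBall E))^[n] (PowerSeries.map ψ Q) =
      PowerSeries.map ψ (PowerSeries.map (τR ^ n) Q) :=
  map_frobUnitBall_symm_iterate_map_eq_of_reading E ψ (fun r ↦ ((ρ r : rayClassField K 𝔪) : AlgebraicClosure K)) hψ σ₀
    (fun r ↦ by rw [hτR, absGaloisRestrict_inv_smul_coe_rayClassField_eq_galFrob_symm h𝔪 hv𝔪 hσ₀]) n Q

/-- ★★★ **de Shalit II.4.9 (ii) for the algebraic theta `t`-expansion: `(Q_R^{ψ_𝔓})^{φ} = Q_R(σ-data)^{ψ_𝔓}`** — with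
`Q_R = C K·∏_{c ∈ T} (invOfUnit (x(P₀ − P(t)) − x_c) u_c)⁶` over `R` (`DeShalitThetaTExpansionIntegral`; `x₀ − x_c = u_c` units) and `σ_R`
a ring endomorphism of `R` covering the Artin symbol `σ_v` on the data: the Frobenius twist of `Q_R^{ψ_𝔓}` is the `ψ_𝔓`-reading of the
expansion of the CONJUGATE data `(W^{σ}, σ x₀, σ y₀, σ x_c, σ K)` (`map_thetaTExpansion`).  This is the hypothesis `hGφ` of
`…KatzMeasureJZeroSeamPerUnit.map_frob_relCoatesWiles_eq_of_bridge` obtained from its `hG` with the same `ψ_𝔓`.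
[cite: deShalit1987, II §4.9 Proposition (ii), II §4.7 (18)] -/
theorem map_frobUnitBall_map_thetaTExpansion_eq {σR : R →+* R} (hσR : ∀ r, ρ (σR r) = galFrob K (rayClassField K 𝔪) v (ρ r))
    (W : WeierstrassCurve R) (x₀ y₀ : R) {ι : Type*} (T : Finset ι) (x : ι → R) (u : ι → Rˣ) (Kc : R)
    (hu : ∀ c ∈ T, (u c : R) = x₀ - x c) :
    PowerSeries.map (frobUnitBall E σ₀ : unitBall E →+* unitBall E)
        (PowerSeries.map ψ (C Kc * ∏ c ∈ T, PowerSeries.invOfUnit ((W.translateX x₀ y₀).subst W.formalNeg - C (x c)) (u c) ^ 6)) =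
      PowerSeries.map ψ (C (σR Kc) * ∏ c ∈ T, PowerSeries.invOfUnit
        (((W.map σR).translateX (σR x₀) (σR y₀)).subst (W.map σR).formalNeg - C (σR (x c))) (Units.map (σR : R →* R) (u c)) ^ 6) := by
  rw [map_frobUnitBall_map_eq_galFrob_of_reading E h𝔪 hv𝔪 hσ₀ ψ ρ hψ hσR, W.map_thetaTExpansion x₀ y₀ σR T x u Kc hu]

/-- ★★★ **de Shalit's `φ⁻ⁿ Q`**: `(φ⁻¹)^{n} (Q_R^{ψ_𝔓}) = Q_R(σ⁻ⁿ-data)^{ψ_𝔓}` with `σ⁻ⁿ = τ_R^n`, `τ_R` covering `σ_v⁻¹` — the series whose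
values at the division points the interpolation property prescribes («`(φ⁻ⁿP)(z) = Θ(Λ(𝔭⁻ⁿ)w_n − z; Λ(𝔭⁻ⁿ)𝔭ⁿL, 𝔞)`»).
[cite: deShalit1987, II §4.9 Proposition (ii) and its proof (p. 62–63)] -/
theorem map_frobUnitBall_symm_iterate_map_thetaTExpansion_eq {τR : R →+* R}
    (hτR : ∀ r, ρ (τR r) = (galFrob K (rayClassField K 𝔪) v).symm (ρ r)) (n : ℕ)
    (W : WeierstrassCurve R) (x₀ y₀ : R) {ι : Type*} (T : Finset ι) (x : ι → R) (u : ι → Rˣ) (Kc : R)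
    (hu : ∀ c ∈ T, (u c : R) = x₀ - x c) :
    (PowerSeries.map ((frobUnitBall E σ₀).symm : unitBall E →+* unitBall E))^[n]
        (PowerSeries.map ψ (C Kc * ∏ c ∈ T, PowerSeries.invOfUnit ((W.translateX x₀ y₀).subst W.formalNeg - C (x c)) (u c) ^ 6)) =
      PowerSeries.map ψ (C ((τR ^ n) Kc) * ∏ c ∈ T, PowerSeries.invOfUnit
        (((W.map (τR ^ n)).translateX ((τR ^ n) x₀) ((τR ^ n) y₀)).subst (W.map (τR ^ n)).formalNeg - C ((τR ^ n) (x c)))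
          (Units.map ((τR ^ n : R →+* R) : R →* R) (u c)) ^ 6) := by
  rw [map_frobUnitBall_symm_iterate_map_eq_galFrob_of_reading E h𝔪 hv𝔪 hσ₀ ψ ρ hψ hτR n,
    W.map_thetaTExpansion x₀ y₀ (τR ^ n) T x u Kc hu]

end Lane

end Literature.NumberTheory.EllipticCurves

end
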